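import Mathlib
import HarnessLib
import Literature.NumberTheory.DiophantineGeometry.SiegelTheoremIntegralPoints
import Literature.Algebra.Polynomial.BivariateGaussLemmaInt

/-!
# Integral values on prime integer plane curves over `ℚ` — the `K = ℚ` dictionary for
`Lang1983_integralValues_planeCurve_parametric`

Topic `NumberTheory/DiophantineGeometry`.  PROVED consumer bridge (no named fact, net debt 0) between
the named fact `Literature.NumberTheory.DiophantineGeometry.Lang1983_integralValues_planeCurve_parametric`
(`SiegelTheoremIntegralPoints.lean`: SIEGEL–MAHLER–LANG, integral values of a non-constant function on an
affine plane curve with infinitely many integral-valued points force a two-pole rational parametrisation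
[cite: Lang1983, Ch. 8, Thm. 2.4 (p. 160) and Thm. 5.1 (pp. 164–165)]) and the currency of its first consumer
(Schanuel line, lens-1 g51 `SiegelShapes`: a PRIME `P ∈ ℤ[x][y]`, rational points with a DYADIC coordinate):

* `rat_subfield_closure_empty_eq_top` — `ℚ` is finitely generated over its prime field (by `∅`), the
  first hypothesis of the fact at `K = ℚ`;
* `mem_subring_closure_inv_two_iff` — the finitely generated subring `ℤ[1/2] = Subring.closure {2⁻¹}`
  of `ℚ` is `{x | x.den is a power of 2}` (the dyadic rationals), so `R = ℤ[1/2]` meets the second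
  hypothesis with `s = {2⁻¹}`;
* `evalEval_map_intCast` — evaluating the `K[x][y]`-image of `P ∈ ℤ[x][y]` at `(x, y) ∈ K²` is
  evaluating `P` coefficientwise at `x` and then at `y` (the consumer's two-variable evaluation);
* `integralValuePoints_infinite_of_fst` — infinitely many `R`-valued first coordinates of zeros give
  infinitely many points of `integralValuePoints R f`;
* **`Lang1983_integralValues_planeCurve_parametric.of_prime_int`** (and `…of_prime_int_fst`) — the fact
  at `K = ℚ` for the `ℚ[x][y]`-image of a prime `P ∈ ℤ[x][y]` of positive `y`-degree, which is
  irreducible over `ℚ` by GAUSS'S LEMMA [cite: Lang2002, Ch. IV, §2, Thm. 2.3 and Cor. 2.4]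
  (`Literature.Algebra.Polynomial.BivariateGauss.irreducible_map_of_prime_int₂`), with the degree
  clause read on `P` itself (`deg_y` is unchanged by the injective coefficient extension `ℤ ↪ ℚ`).

## References
* [Lang1983] S. Lang, *Fundamentals of Diophantine Geometry*, Springer 1983, Ch. 8 §2 Thm. 2.4, §5
  Thm. 5.1 and the remark p. 165 (integral values of one function; plane curves).
* [Lang2002] S. Lang, *Algebra*, rev. 3rd ed., GTM 211, Springer 2002, Ch. IV §2 Thm. 2.3, Cor. 2.4
  (Gauss lemma: primes of `A[X₁,…,Xₙ]` of positive degree are irreducible over the fraction field).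
* [Siegel1929] C. L. Siegel, *Über einige Anwendungen diophantischer Approximationen*, Abh. Preuss.
  Akad. Wiss. 1929, Nr. 1 (the theorem on integral points; parametric statement typed in
  `SiegelTheoremIntegralPoints.lean`).
-/

noncomputable section

open Polynomial
open scoped Polynomial.Bivariate

namespace Literature.NumberTheory.DiophantineGeometry

/-! ## The two finite-generation hypotheses at `K = ℚ` -/

/-- [cite: Lang1983, Ch. 8, §2, p. 160 («`K` a finitely generated field over the prime field»)] `ℚ` is
its own prime field: the subfield generated by `∅` is everything (every `q = num q / den q` lies in any
subfield). -/
theorem rat_subfield_closure_empty_eq_top :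
    Subfield.closure ((∅ : Finset ℚ) : Set ℚ) = ⊤ := by
  refine eq_top_iff.2 fun q _ => ?_
  have h := (Subfield.closure ((∅ : Finset ℚ) : Set ℚ)).div_mem
    (intCast_mem (Subfield.closure ((∅ : Finset ℚ) : Set ℚ)) q.num)
    (natCast_mem (Subfield.closure ((∅ : Finset ℚ) : Set ℚ)) q.den)
  rwa [Rat.num_div_den] at h

/-- [cite: Lang1983, Ch. 8, §2, p. 160 (hypothesis «`K` finitely generated over the prime field»)]
The first hypothesis of `Lang1983_integralValues_planeCurve_parametric` holds at `K = ℚ`. -/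
theorem rat_exists_finset_subfield_closure_eq_top :
    ∃ s : Finset ℚ, Subfield.closure (s : Set ℚ) = ⊤ :=
  ⟨∅, rat_subfield_closure_empty_eq_top⟩

/-- [cite: Lang1983, Ch. 8, §2, p. 160 («`R` a subring of `K` finitely generated over `ℤ`»; the ring
of `S`-integers `ℤ[1/2]` of BombieriGubler2006 Thm. 7.3.9 at `K = ℚ`, `S = {2, ∞}`)] The finitely
generated subring `ℤ[1/2] = Subring.closure {2⁻¹}` of `ℚ` consists exactly of the DYADIC rationals
(denominator a power of `2`). -/
theorem mem_subring_closure_inv_two_iff (x : ℚ) :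
    x ∈ Subring.closure ({(2 : ℚ)⁻¹} : Set ℚ) ↔ ∃ k : ℕ, x.den = 2 ^ k := by
  constructor
  · intro hx
    induction hx using Subring.closure_induction with
    | mem y hy =>
      rw [Set.mem_singleton_iff] at hy
      subst hy
      refine ⟨1, ?_⟩
      rw [show (2 : ℚ)⁻¹ = ((2 : ℕ) : ℚ)⁻¹ by norm_num, Rat.inv_natCast_den]
      simp
    | zero => exact ⟨0, by simp⟩
    | one => exact ⟨0, by simp⟩
    | add y z _ _ hy hz =>
      obtain ⟨k, hk⟩ := hy
      obtain ⟨l, hl⟩ := hz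
      have hdvd : (y + z).den ∣ 2 ^ (k + l) := by
        rw [pow_add, ← hk, ← hl]
        exact Rat.add_den_dvd y z
      obtain ⟨m, -, hm⟩ := (Nat.dvd_prime_pow Nat.prime_two).1 hdvd
      exact ⟨m, hm⟩
    | neg y _ hy => simpa only [Rat.neg_den] using hy
    | mul y z _ _ hy hz =>
      obtain ⟨k, hk⟩ := hy
      obtain ⟨l, hl⟩ := hz
      have hdvd : (y * z).den ∣ 2 ^ (k + l) := by
        rw [pow_add, ← hk, ← hl]
        exact Rat.mul_den_dvd y z
      obtain ⟨m, -, hm⟩ := (Nat.dvd_prime_pow Nat.prime_two).1 hdvd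
      exact ⟨m, hm⟩
  · rintro ⟨k, hk⟩
    have hden : ((x.den : ℕ) : ℚ) = 2 ^ k := by
      rw [hk]
      push_cast
      rfl
    have hx : x = (x.num : ℚ) * ((2 : ℚ)⁻¹) ^ k := by
      rw [inv_pow, ← div_eq_mul_inv, ← hden, Rat.num_div_den]
    rw [hx]
    exact mul_mem (intCast_mem _ x.num)
      (pow_mem (Subring.subset_closure (Set.mem_singleton _)) k)

/-! ## Evaluation and points dictionaries -/

/-- [cite: Lang1983, Ch. 8, §5, p. 165 (the coordinate functions `x, y` of the plane curve
`f(x, y) = 0`)] Evaluating the `K[x][y]`-image of `P ∈ ℤ[x][y]` at `(x, y) ∈ K²` equals evaluating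
`P` coefficientwise at `x` (`aeval x : ℤ[x] → K`) and then at `y` — the two-variable evaluation used by
consumers working with integer polynomials. -/
theorem evalEval_map_intCast {K : Type*} [CommRing K] (P : ℤ[X][Y]) (x y : K) :
    (P.map (mapRingHom (Int.castRingHom K))).evalEval x y =
      (P.map (aeval x : ℤ[X] →ₐ[ℤ] K).toRingHom).eval y := by
  have key : (evalEvalRingHom x y).comp (mapRingHom (mapRingHom (Int.castRingHom K))) =
      (evalRingHom y).comp (mapRingHom (aeval x : ℤ[X] →ₐ[ℤ] K).toRingHom) := by
    refine Polynomial.ringHom_ext (fun a => ?_) ?_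
    · simp only [RingHom.comp_apply, coe_mapRingHom, map_C, coe_evalRingHom, eval_C, eval_map,
        AlgHom.toRingHom_eq_coe, RingHom.coe_coe, aeval_def, algebraMap_int_eq]
    · simp only [RingHom.comp_apply, coe_mapRingHom, map_X, coe_evalRingHom, eval_X, eval_C]
  exact RingHom.congr_fun key P

/-- [cite: Lang1983, Ch. 8, §5, Thm. 5.1, p. 164 («infinitely many points in `R`», read through the
first coordinate)] If infinitely many `x ∈ R` are first coordinates of zeros of `f` in `K²`, then
`integralValuePoints R f` is infinite. -/
theorem integralValuePoints_infinite_of_fst {K : Type*} [Field K] (R : Subring K) (f : K[X][Y])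
    (h : {x : K | x ∈ R ∧ ∃ y : K, f.evalEval x y = 0}.Infinite) :
    (integralValuePoints R f).Infinite := by
  have hsub : {x : K | x ∈ R ∧ ∃ y : K, f.evalEval x y = 0} ⊆ Prod.fst '' integralValuePoints R f := by
    rintro x ⟨hx, y, hy⟩
    exact ⟨(x, y), (mem_integralValuePoints R f (x, y)).2 ⟨hy, hx⟩, rfl⟩
  exact fun hfin => h ((hfin.image Prod.fst).subset hsub)

/-- [cite: Lang2002, Ch. IV, §2, Thm. 2.3 (the coefficient extension `A[X] → K[X]` is injective, so
degrees are preserved)] The `y`-degree of `P ∈ ℤ[x][y]` is unchanged in `ℚ[x][y]`. -/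
theorem natDegree_map_intCast₂ (P : ℤ[X][Y]) :
    (P.map (mapRingHom (Int.castRingHom ℚ))).natDegree = P.natDegree :=
  natDegree_map_eq_of_injective
    (map_injective (Int.castRingHom ℚ) (RingHom.injective_int (Int.castRingHom ℚ))) P

/-! ## The fact at `K = ℚ` for prime integer plane curves -/

/-- **Integral values on a prime integer plane curve over `ℚ`** [cite: Lang1983, Ch. 8, Thm. 2.4
(p. 160) and Thm. 5.1 (pp. 164–165); Lang2002, Ch. IV, §2, Thm. 2.3 and Cor. 2.4 (Gauss lemma)] — the
named fact `Lang1983_integralValues_planeCurve_parametric` (consumed as the hypothesis `h`) specialised to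
`K = ℚ` (finitely generated over its prime field by `∅`), `R` any finitely generated subring of `ℚ`, and
`f` the `ℚ[x][y]`-image of a PRIME `P ∈ ℤ[x][y]` with `1 ≤ deg_y P`, which is irreducible over `ℚ` by
`Literature.Algebra.Polynomial.BivariateGauss.irreducible_map_of_prime_int₂`; the degree clause is read
on `P`.  Conclusion verbatim the fact's: a rational parametrisation `(Pt, Qt)` of the curve, proper
over the `x`-line, with `Pt` of LANG's two-pole shape, covering all but finitely many rational points of
the curve by parameters `t ∈ ℚ` off the poles, and `deg Pt = deg_y P`. -/
theorem Lang1983_integralValues_planeCurve_parametric.of_prime_int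
    (h : Lang1983_integralValues_planeCurve_parametric) (R : Subring ℚ)
    (hR : ∃ s : Finset ℚ, Subring.closure (s : Set ℚ) = R) {P : ℤ[X][Y]} (hP : Prime P)
    (hdeg : 1 ≤ P.natDegree)
    (hinf : (integralValuePoints R (P.map (mapRingHom (Int.castRingHom ℚ)))).Infinite) :
    ∃ Pt Qt : RatFunc ℚ, evalRatFunc (P.map (mapRingHom (Int.castRingHom ℚ))) Pt Qt = 0 ∧
      (∃ g h' : ℚ[X][Y], evalRatFunc h' Pt Qt ≠ 0 ∧
        evalRatFunc g Pt Qt = RatFunc.X * evalRatFunc h' Pt Qt) ∧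
      LangTwoPoleShape Pt ∧
      (∃ E : Finset (ℚ × ℚ), ∀ x y : ℚ, (P.map (mapRingHom (Int.castRingHom ℚ))).evalEval x y = 0 →
        (x, y) ∈ E ∨ ∃ t : ℚ, Pt.denom.eval t ≠ 0 ∧ Qt.denom.eval t ≠ 0 ∧
          Pt.eval (RingHom.id ℚ) t = x ∧ Qt.eval (RingHom.id ℚ) t = y) ∧
      max Pt.num.natDegree Pt.denom.natDegree = P.natDegree := by
  unfold Lang1983_integralValues_planeCurve_parametric at h
  obtain ⟨Pt, Qt, h1, h2, h3, h4, h5⟩ := h ℚ rat_exists_finset_subfield_closure_eq_top R hR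
    (P.map (mapRingHom (Int.castRingHom ℚ)))
    (Literature.Algebra.Polynomial.BivariateGauss.irreducible_map_of_prime_int₂ hP hdeg) hinf
  exact ⟨Pt, Qt, h1, h2, h3, h4, h5.trans (natDegree_map_intCast₂ P)⟩

/-- [cite: Lang1983, Ch. 8, Thm. 2.4 (p. 160) and Thm. 5.1 (pp. 164–165); Lang2002, Ch. IV, §2,
Thm. 2.3] The same, with the infinitude hypothesis on the `R`-valued FIRST COORDINATES of rational zeros
of `P` (the form in which the consumer negates «only finitely many `x ∈ R` occur»). -/
theorem Lang1983_integralValues_planeCurve_parametric.of_prime_int_fst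
    (h : Lang1983_integralValues_planeCurve_parametric) (R : Subring ℚ)
    (hR : ∃ s : Finset ℚ, Subring.closure (s : Set ℚ) = R) {P : ℤ[X][Y]} (hP : Prime P)
    (hdeg : 1 ≤ P.natDegree)
    (hinf : {x : ℚ | x ∈ R ∧ ∃ y : ℚ,
      (P.map (mapRingHom (Int.castRingHom ℚ))).evalEval x y = 0}.Infinite) :
    ∃ Pt Qt : RatFunc ℚ, evalRatFunc (P.map (mapRingHom (Int.castRingHom ℚ))) Pt Qt = 0 ∧
      (∃ g h' : ℚ[X][Y], evalRatFunc h' Pt Qt ≠ 0 ∧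
        evalRatFunc g Pt Qt = RatFunc.X * evalRatFunc h' Pt Qt) ∧
      LangTwoPoleShape Pt ∧
      (∃ E : Finset (ℚ × ℚ), ∀ x y : ℚ, (P.map (mapRingHom (Int.castRingHom ℚ))).evalEval x y = 0 →
        (x, y) ∈ E ∨ ∃ t : ℚ, Pt.denom.eval t ≠ 0 ∧ Qt.denom.eval t ≠ 0 ∧
          Pt.eval (RingHom.id ℚ) t = x ∧ Qt.eval (RingHom.id ℚ) t = y) ∧
      max Pt.num.natDegree Pt.denom.natDegree = P.natDegree :=
  Lang1983_integralValues_planeCurve_parametric.of_prime_int h R hR hP hdeg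
    (integralValuePoints_infinite_of_fst R _ hinf)

/-- [cite: Lang1983, Ch. 8, Thm. 2.4 (p. 160) and Thm. 5.1 (pp. 164–165); BombieriGubler2006,
Thm. 7.3.9 with Rem. 7.3.10 (pp. 178–179), `S = {2, ∞}`] The DYADIC instance: `R = ℤ[1/2]`, the
infinitude hypothesis stated with «`x.den` is a power of `2`». -/
theorem Lang1983_integralValues_planeCurve_parametric.of_prime_int_dyadic
    (h : Lang1983_integralValues_planeCurve_parametric) {P : ℤ[X][Y]} (hP : Prime P)
    (hdeg : 1 ≤ P.natDegree)
    (hinf : {x : ℚ | (∃ k : ℕ, x.den = 2 ^ k) ∧ ∃ y : ℚ,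
      (P.map (mapRingHom (Int.castRingHom ℚ))).evalEval x y = 0}.Infinite) :
    ∃ Pt Qt : RatFunc ℚ, evalRatFunc (P.map (mapRingHom (Int.castRingHom ℚ))) Pt Qt = 0 ∧
      (∃ g h' : ℚ[X][Y], evalRatFunc h' Pt Qt ≠ 0 ∧
        evalRatFunc g Pt Qt = RatFunc.X * evalRatFunc h' Pt Qt) ∧
      LangTwoPoleShape Pt ∧
      (∃ E : Finset (ℚ × ℚ), ∀ x y : ℚ, (P.map (mapRingHom (Int.castRingHom ℚ))).evalEval x y = 0 →
        (x, y) ∈ E ∨ ∃ t : ℚ, Pt.denom.eval t ≠ 0 ∧ Qt.denom.eval t ≠ 0 ∧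
          Pt.eval (RingHom.id ℚ) t = x ∧ Qt.eval (RingHom.id ℚ) t = y) ∧
      max Pt.num.natDegree Pt.denom.natDegree = P.natDegree := by
  refine Lang1983_integralValues_planeCurve_parametric.of_prime_int_fst h
    (Subring.closure ({(2 : ℚ)⁻¹} : Set ℚ)) ⟨{(2 : ℚ)⁻¹}, by rw [Finset.coe_singleton]⟩ hP hdeg ?_
  convert hinf using 2 with x
  simp only [mem_subring_closure_inv_two_iff]

end Literature.NumberTheory.DiophantineGeometry

end
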